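import Summits.AtomisticToContinuum.Crystallization.Theorems.ExcessDecayLiouvilleParamArithC
import Summits.AtomisticToContinuum.BoseEinsteinCondensation.Theorems.PuffFloor.Negative.PuffFloorFalseForNearMinimisers

/-!
# Route `ExcessDecayLiouville`: the slope budget of phase two, term by term (pure arithmetic, D)

Harmonic-replacement architecture for item `ExcessDecay` (stmt-AtomisticToContinuum-9334), nonlinear half.
The squared slope scale `γ₀²ρ₀` at the top of phase two (`ρ₀ = σ₀² ∈ [r/(16L⁹⁰), r/L⁷⁰]`,
`γ₀² = 64C₁ + L¹¹⁴·floorAgg`) is bounded term by term by `L²⁰ε²/r² + L⁴⁷⁰/(δ⁶r⁶)`; the squared height scale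
`γ₀²ρ₀³ ≤ γ₀²ρ₀ · r²/L¹⁴⁰` follows.  Positive powers of `ρ₀` use the upper bound, negative ones the lower bound.
All `[folklore]`; pure real inequalities, nothing here closes an item.
-/

namespace Summit.AtomisticToContinuum.Crystallization.Theorems.ExcessDecayLiouville

open Summit.AtomisticToContinuum.BoseEinsteinCondensation.Theorems.PuffFloor.Negative (sq_le_two_sq_add_two_sq)

/-- **Slope budget, Taylor term**: `448K²σ⋆²ρ₀ ≤ L²⁰ε²/r² + L⁴⁷⁰/(δ⁶r⁶)`. [folklore] -/
theorem slope_K {L δ r ε K σs ρ₀ : ℝ} (hL : 239000000 ≤ L) (hδ : 0 < δ) (hr : L ^ 400 ≤ r)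
    (hK0 : 0 ≤ K) (hK : K ≤ L ^ 45 * ε / r ^ 2 + L ^ 263 / (δ ^ 3 * r ^ 4))
    (hρhi : σs ^ 2 ≤ r / 737600) (hρ₀0 : 0 ≤ ρ₀) (hρ₀hi : ρ₀ ≤ r / L ^ 70) :
    64 * (7 * K ^ 2 * σs ^ 2) * ρ₀ ≤ L ^ 20 * ε ^ 2 / r ^ 2 + L ^ 470 / (δ ^ 6 * r ^ 6) := by
  have hL1 : (1 : ℝ) ≤ L := by linarith
  have hL0 : (0 : ℝ) < L := by linarith
  have hr0 : 0 < r := lt_of_lt_of_le (by positivity) hr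
  have hK2 := sq_le_two_sq_add_two_sq hK0 hK
  have hprod : σs ^ 2 * ρ₀ ≤ (r / 737600) * (r / L ^ 70) := mul_le_mul hρhi hρ₀hi hρ₀0 (by positivity)
  have h0 : 0 ≤ 2 * (L ^ 45 * ε / r ^ 2) ^ 2 + 2 * (L ^ 263 / (δ ^ 3 * r ^ 4)) ^ 2 := by positivity
  calc 64 * (7 * K ^ 2 * σs ^ 2) * ρ₀ = 448 * K ^ 2 * (σs ^ 2 * ρ₀) := by ring
    _ ≤ 448 * (2 * (L ^ 45 * ε / r ^ 2) ^ 2 + 2 * (L ^ 263 / (δ ^ 3 * r ^ 4)) ^ 2) * ((r / 737600) * (r / L ^ 70)) := by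
        gcongr
    _ = (896 / 737600) * L ^ 20 * ε ^ 2 / r ^ 2 + (896 / 737600) * L ^ 456 / (δ ^ 6 * r ^ 6) := by
        field_simp; ring
    _ ≤ L ^ 20 * ε ^ 2 / r ^ 2 + L ^ 470 / (δ ^ 6 * r ^ 6) := by
        have h1 : (896 / 737600) * L ^ 20 * ε ^ 2 / r ^ 2 ≤ L ^ 20 * ε ^ 2 / r ^ 2 :=
          div_le_div_of_nonneg_right (by nlinarith [pow_nonneg hL0.le 20, sq_nonneg ε, mul_nonneg (pow_nonneg hL0.le 20) (sq_nonneg ε)]) (by positivity)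
        have h2 : (896 / 737600) * L ^ 456 / (δ ^ 6 * r ^ 6) ≤ L ^ 470 / (δ ^ 6 * r ^ 6) := by
          refine div_le_div_of_nonneg_right ?_ (by positivity)
          have : L ^ 456 ≤ L ^ 470 := pow_le_pow_right₀ hL1 (by norm_num)
          nlinarith [pow_nonneg hL0.le 456]
        exact add_le_add h1 h2

/-- **Slope budget, shift term**: `384s²/ρ₀² ≤ L²⁰ε²/r² + L⁴⁷⁰/(δ⁶r⁶)`. [folklore] -/
theorem slope_s {L δ r ε s ρ₀ : ℝ} (hL : 239000000 ≤ L) (hδ : 0 < δ) (hr : L ^ 400 ≤ r)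
    (hs0 : 0 ≤ s) (hs : s ≤ L ^ 16 * ε / r + L ^ 14 / (δ ^ 3 * r ^ 3))
    (hρ₀lo : r / (16 * L ^ 90) ≤ ρ₀) :
    64 * (6 * s ^ 2 / ρ₀ ^ 3) * ρ₀ ≤ L ^ 20 * ε ^ 2 / r ^ 2 + L ^ 470 / (δ ^ 6 * r ^ 6) := by
  have hL1 : (1 : ℝ) ≤ L := by linarith
  have hL0 : (0 : ℝ) < L := by linarith
  have hr0 : 0 < r := lt_of_lt_of_le (by positivity) hr
  have hρ₀0 : 0 < ρ₀ := lt_of_lt_of_le (by positivity) hρ₀lo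
  have hs2 := sq_le_two_sq_add_two_sq hs0 hs
  have hinv : 1 / ρ₀ ≤ 16 * L ^ 90 / r := by
    rw [div_le_div_iff₀ hρ₀0 hr0]; rw [div_le_iff₀ (by positivity)] at hρ₀lo; linarith
  have hinv2 : (1 / ρ₀) ^ 2 ≤ (16 * L ^ 90 / r) ^ 2 := pow_le_pow_left₀ (by positivity) hinv 2
  have e : 64 * (6 * s ^ 2 / ρ₀ ^ 3) * ρ₀ = 384 * s ^ 2 * (1 / ρ₀) ^ 2 := by field_simp; ring
  rw [e]
  have h0 : 0 ≤ 2 * (L ^ 16 * ε / r) ^ 2 + 2 * (L ^ 14 / (δ ^ 3 * r ^ 3)) ^ 2 := by positivity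
  calc 384 * s ^ 2 * (1 / ρ₀) ^ 2 ≤ 384 * (2 * (L ^ 16 * ε / r) ^ 2 + 2 * (L ^ 14 / (δ ^ 3 * r ^ 3)) ^ 2) * (16 * L ^ 90 / r) ^ 2 := by
        gcongr
    _ = (196608 * L ^ 192 * (1 / r) ^ 2) * (L ^ 20 * ε ^ 2 / r ^ 2) + (196608 * L ^ 208 * (1 / r) ^ 2) * (L ^ 0 / (δ ^ 6 * r ^ 6)) := by
        field_simp; ring
    _ ≤ 1 * (L ^ 20 * ε ^ 2 / r ^ 2) + 1 * (L ^ 0 / (δ ^ 6 * r ^ 6)) := by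
        have c1 : 196608 * L ^ 192 * (1 / r) ^ 2 ≤ 1 := coef_small_sq hL1 hr (by norm_num) (by linarith) (by norm_num)
        have c2 : 196608 * L ^ 208 * (1 / r) ^ 2 ≤ 1 := coef_small_sq hL1 hr (by norm_num) (by linarith) (by norm_num)
        exact add_le_add (mul_le_mul_of_nonneg_right c1 (by positivity)) (mul_le_mul_of_nonneg_right c2 (by positivity))
    _ ≤ L ^ 20 * ε ^ 2 / r ^ 2 + L ^ 470 / (δ ^ 6 * r ^ 6) := by
        rw [one_mul, one_mul]
        refine add_le_add le_rfl (div_le_div_of_nonneg_right ?_ (by positivity))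
        exact pow_le_pow_right₀ hL1 (by norm_num)

/-- **Slope budget, old-mass term**: `128ε'²ρ₀/σ⋆⁶ ≤ L²⁰ε²/r² + L⁴⁷⁰/(δ⁶r⁶)`. [folklore] -/
theorem slope_epsP {L δ r ε εp σs ρ₀ : ℝ} (hL : 239000000 ≤ L) (hδ : 0 < δ) (hr : L ^ 400 ≤ r)
    (hεp0 : 0 ≤ εp) (hεp : εp ≤ L ^ 2 * ε + L ^ 2 / (δ ^ 3 * r ^ 4))
    (hρlo : r / 1475200 ≤ σs ^ 2) (hρ₀0 : 0 ≤ ρ₀) (hρ₀hi : ρ₀ ≤ r / L ^ 70) :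
    64 * (2 * εp ^ 2 / σs ^ 6) * ρ₀ ≤ L ^ 20 * ε ^ 2 / r ^ 2 + L ^ 470 / (δ ^ 6 * r ^ 6) := by
  have hL1 : (1 : ℝ) ≤ L := by linarith
  have hL0 : (0 : ℝ) < L := by linarith
  have hr0 : 0 < r := lt_of_lt_of_le (by positivity) hr
  have hρs0 : 0 < σs ^ 2 := lt_of_lt_of_le (by positivity) hρlo
  have hε2 := sq_le_two_sq_add_two_sq hεp0 hεp
  have hρ₀r : ρ₀ ≤ r := hρ₀hi.trans (div_le_self hr0.le (one_le_pow₀ hL1))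
  have hinv : 1 / σs ^ 2 ≤ 1475200 / r := by
    rw [div_le_div_iff₀ hρs0 hr0]; rw [div_le_iff₀ (by norm_num)] at hρlo; linarith
  have hinv3 : (1 / σs ^ 2) ^ 3 ≤ (1475200 / r) ^ 3 := pow_le_pow_left₀ (by positivity) hinv 3
  have e : 64 * (2 * εp ^ 2 / σs ^ 6) * ρ₀ = 128 * εp ^ 2 * (1 / σs ^ 2) ^ 3 * ρ₀ := by field_simp; ring
  rw [e]
  have h0 : 0 ≤ 2 * (L ^ 2 * ε) ^ 2 + 2 * (L ^ 2 / (δ ^ 3 * r ^ 4)) ^ 2 := by positivity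
  calc 128 * εp ^ 2 * (1 / σs ^ 2) ^ 3 * ρ₀ ≤ 128 * (2 * (L ^ 2 * ε) ^ 2 + 2 * (L ^ 2 / (δ ^ 3 * r ^ 4)) ^ 2) * (1475200 / r) ^ 3 * r := by
        gcongr
    _ = (256 * 1475200 ^ 3 * L ^ 4) * (ε ^ 2 / r ^ 2) + ((256 * 1475200 ^ 3) * L ^ 4 * (1 / r) ^ 2) * (L ^ 0 / (δ ^ 6 * r ^ 6)) * (1 / r) ^ 2 := by
        field_simp; ring
    _ ≤ L ^ 20 * (ε ^ 2 / r ^ 2) + 1 * (L ^ 0 / (δ ^ 6 * r ^ 6)) * 1 := by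
        have hL4 : (239000000 : ℝ) ^ 4 ≤ L ^ 4 := pow_le_pow_left₀ (by norm_num) hL 4
        have c1 : 256 * 1475200 ^ 3 * L ^ 4 ≤ L ^ 20 := by
          have : L ^ 20 = L ^ 16 * L ^ 4 := by ring
          rw [this]
          refine mul_le_mul_of_nonneg_right ?_ (by positivity)
          calc (256 * 1475200 ^ 3 : ℝ) ≤ 239000000 ^ 4 := by norm_num
            _ ≤ L ^ 4 := hL4
            _ ≤ L ^ 16 := pow_le_pow_right₀ hL1 (by norm_num)
        have c2 : (256 * 1475200 ^ 3) * L ^ 4 * (1 / r) ^ 2 ≤ 1 := by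
          have h := coef_small_sq (c := (1 : ℝ)) (a := 8) hL1 hr (by norm_num) hL1 (by norm_num)
          have h2 : (256 * 1475200 ^ 3 : ℝ) * L ^ 4 ≤ 1 * L ^ 8 := by
            have : (1 : ℝ) * L ^ 8 = L ^ 4 * L ^ 4 := by ring
            rw [this]; exact mul_le_mul_of_nonneg_right (le_trans (by norm_num) hL4) (by positivity)
          exact (mul_le_mul_of_nonneg_right h2 (by positivity)).trans h
        have c3 : (1 / r) ^ 2 ≤ 1 := by
          have : 1 / r ≤ 1 := by rw [div_le_one hr0]; exact le_trans (one_le_pow₀ hL1) hr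
          exact pow_le_one₀ (by positivity) this
        gcongr
    _ ≤ L ^ 20 * ε ^ 2 / r ^ 2 + L ^ 470 / (δ ^ 6 * r ^ 6) := by
        rw [one_mul, mul_one, ← mul_div_assoc]
        refine add_le_add le_rfl (div_le_div_of_nonneg_right ?_ (by positivity))
        exact pow_le_pow_right₀ hL1 (by norm_num)

/-- **Slope budget, value/shift increment term**: `256(Vₐ+s)²ρ₀/σ⋆⁶ ≤ L²⁰ε²/r² + L⁴⁷⁰/(δ⁶r⁶)`. [folklore] -/
theorem slope_Vas {L δ r ε Va s σs ρ₀ : ℝ} (hL : 239000000 ≤ L) (hδ : 0 < δ) (hr : L ^ 400 ≤ r)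
    (hVas0 : 0 ≤ Va + s) (hVas : Va + s ≤ L ^ 12 * ε + L ^ 10 / (δ ^ 3 * r ^ 2))
    (hρlo : r / 1475200 ≤ σs ^ 2) (hρ₀0 : 0 ≤ ρ₀) (hρ₀hi : ρ₀ ≤ r / L ^ 70) :
    64 * (4 * (Va + s) ^ 2 / σs ^ 6) * ρ₀ ≤ L ^ 20 * ε ^ 2 / r ^ 2 + L ^ 470 / (δ ^ 6 * r ^ 6) := by
  have hL1 : (1 : ℝ) ≤ L := by linarith
  have hL0 : (0 : ℝ) < L := by linarith
  have hr0 : 0 < r := lt_of_lt_of_le (by positivity) hr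
  have hρs0 : 0 < σs ^ 2 := lt_of_lt_of_le (by positivity) hρlo
  have h2 := sq_le_two_sq_add_two_sq hVas0 hVas
  have hinv : 1 / σs ^ 2 ≤ 1475200 / r := by
    rw [div_le_div_iff₀ hρs0 hr0]; rw [div_le_iff₀ (by norm_num)] at hρlo; linarith
  have hinv3 : (1 / σs ^ 2) ^ 3 ≤ (1475200 / r) ^ 3 := pow_le_pow_left₀ (by positivity) hinv 3
  have e : 64 * (4 * (Va + s) ^ 2 / σs ^ 6) * ρ₀ = 256 * (Va + s) ^ 2 * (1 / σs ^ 2) ^ 3 * ρ₀ := by field_simp; ring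
  rw [e]
  have h0 : 0 ≤ 2 * (L ^ 12 * ε) ^ 2 + 2 * (L ^ 10 / (δ ^ 3 * r ^ 2)) ^ 2 := by positivity
  calc 256 * (Va + s) ^ 2 * (1 / σs ^ 2) ^ 3 * ρ₀
      ≤ 256 * (2 * (L ^ 12 * ε) ^ 2 + 2 * (L ^ 10 / (δ ^ 3 * r ^ 2)) ^ 2) * (1475200 / r) ^ 3 * (r / L ^ 70) := by gcongr
    _ = (512 * 1475200 ^ 3 * L ^ 24 / L ^ 70) * (ε ^ 2 / r ^ 2) + (512 * 1475200 ^ 3 * L ^ 20 / L ^ 70) * (1 / (δ ^ 6 * r ^ 6)) := by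
        field_simp; ring
    _ ≤ L ^ 20 * (ε ^ 2 / r ^ 2) + L ^ 470 * (1 / (δ ^ 6 * r ^ 6)) := by
        have hc : (512 * 1475200 ^ 3 : ℝ) ≤ L ^ 3 := le_trans (by norm_num) (pow_le_pow_left₀ (by norm_num) hL 3)
        have c1 : 512 * 1475200 ^ 3 * L ^ 24 / L ^ 70 ≤ L ^ 20 := by
          rw [div_le_iff₀ (by positivity)]
          calc 512 * 1475200 ^ 3 * L ^ 24 ≤ L ^ 3 * L ^ 24 := mul_le_mul_of_nonneg_right hc (by positivity)
            _ = L ^ 27 := by ring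
            _ ≤ L ^ 90 := pow_le_pow_right₀ hL1 (by norm_num)
            _ = L ^ 20 * L ^ 70 := by ring
        have c2 : 512 * 1475200 ^ 3 * L ^ 20 / L ^ 70 ≤ L ^ 470 := by
          rw [div_le_iff₀ (by positivity)]
          calc 512 * 1475200 ^ 3 * L ^ 20 ≤ L ^ 3 * L ^ 20 := mul_le_mul_of_nonneg_right hc (by positivity)
            _ = L ^ 23 := by ring
            _ ≤ L ^ 540 := pow_le_pow_right₀ hL1 (by norm_num)
            _ = L ^ 470 * L ^ 70 := by ring
        gcongr
    _ = L ^ 20 * ε ^ 2 / r ^ 2 + L ^ 470 / (δ ^ 6 * r ^ 6) := by ring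

/-- **Slope budget, slope increment term**: `(1344/5) b²ρ₀/σ⋆² ≤ L²⁰ε²/r² + L⁴⁷⁰/(δ⁶r⁶)`. [folklore] -/
theorem slope_bT {L δ r ε bT σs ρ₀ : ℝ} (hL : 239000000 ≤ L) (hδ : 0 < δ) (hr : L ^ 400 ≤ r)
    (hbT0 : 0 ≤ bT) (hbT : bT ≤ L ^ 13 * ε / r + L ^ 11 / (δ ^ 3 * r ^ 3))
    (hρlo : r / 1475200 ≤ σs ^ 2) (hρ₀0 : 0 ≤ ρ₀) (hρ₀hi : ρ₀ ≤ r / L ^ 70) :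
    64 * ((21 / 5) * bT ^ 2 / σs ^ 2) * ρ₀ ≤ L ^ 20 * ε ^ 2 / r ^ 2 + L ^ 470 / (δ ^ 6 * r ^ 6) := by
  have hL1 : (1 : ℝ) ≤ L := by linarith
  have hL0 : (0 : ℝ) < L := by linarith
  have hr0 : 0 < r := lt_of_lt_of_le (by positivity) hr
  have hρs0 : 0 < σs ^ 2 := lt_of_lt_of_le (by positivity) hρlo
  have h2 := sq_le_two_sq_add_two_sq hbT0 hbT
  have hinv : 1 / σs ^ 2 ≤ 1475200 / r := by
    rw [div_le_div_iff₀ hρs0 hr0]; rw [div_le_iff₀ (by norm_num)] at hρlo; linarith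
  have e : 64 * ((21 / 5) * bT ^ 2 / σs ^ 2) * ρ₀ = (1344 / 5) * bT ^ 2 * (1 / σs ^ 2) * ρ₀ := by field_simp; ring
  rw [e]
  have h0 : 0 ≤ 2 * (L ^ 13 * ε / r) ^ 2 + 2 * (L ^ 11 / (δ ^ 3 * r ^ 3)) ^ 2 := by positivity
  calc (1344 / 5) * bT ^ 2 * (1 / σs ^ 2) * ρ₀
      ≤ (1344 / 5) * (2 * (L ^ 13 * ε / r) ^ 2 + 2 * (L ^ 11 / (δ ^ 3 * r ^ 3)) ^ 2) * (1475200 / r) * (r / L ^ 70) := by gcongr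
    _ = ((2688 / 5) * 1475200 * L ^ 26 / L ^ 70) * (ε ^ 2 / r ^ 2) + ((2688 / 5) * 1475200 * L ^ 22 / L ^ 70) * (1 / (δ ^ 6 * r ^ 6)) := by
        field_simp; ring
    _ ≤ L ^ 20 * (ε ^ 2 / r ^ 2) + L ^ 470 * (1 / (δ ^ 6 * r ^ 6)) := by
        have hc : ((2688 / 5) * 1475200 : ℝ) ≤ L ^ 2 := le_trans (by norm_num) (pow_le_pow_left₀ (by norm_num) hL 2)
        have c1 : (2688 / 5) * 1475200 * L ^ 26 / L ^ 70 ≤ L ^ 20 := by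
          rw [div_le_iff₀ (by positivity)]
          calc (2688 / 5) * 1475200 * L ^ 26 ≤ L ^ 2 * L ^ 26 := mul_le_mul_of_nonneg_right hc (by positivity)
            _ = L ^ 28 := by ring
            _ ≤ L ^ 90 := pow_le_pow_right₀ hL1 (by norm_num)
            _ = L ^ 20 * L ^ 70 := by ring
        have c2 : (2688 / 5) * 1475200 * L ^ 22 / L ^ 70 ≤ L ^ 470 := by
          rw [div_le_iff₀ (by positivity)]
          calc (2688 / 5) * 1475200 * L ^ 22 ≤ L ^ 2 * L ^ 22 := mul_le_mul_of_nonneg_right hc (by positivity)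
            _ = L ^ 24 := by ring
            _ ≤ L ^ 540 := pow_le_pow_right₀ hL1 (by norm_num)
            _ = L ^ 470 * L ^ 70 := by ring
        gcongr
    _ = L ^ 20 * ε ^ 2 / r ^ 2 + L ^ 470 / (δ ^ 6 * r ^ 6) := by ring

/-- **Slope budget, absorbed floors**: `L¹¹⁴·floorAgg·σ₀² ≤ L²⁰ε²/r² + L⁴⁷⁰/(δ⁶r⁶)`. [folklore] -/
theorem slope_floor {L δ r ε Φ ν Du σ₀ : ℝ} (hL : 239000000 ≤ L) (hδ : 0 < δ) (hr : L ^ 400 ≤ r)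
    (hσ₀ : 1 ≤ σ₀ ^ 2) (hρ₀hi : σ₀ ^ 2 ≤ r / L ^ 70)
    (hΦ0 : 0 ≤ Φ) (hΦ : Φ ≤ 4 * L / (δ ^ 3 * r ^ 4))
    (hν0 : 0 ≤ ν) (hν : ν ≤ 2 * L ^ 32 * ε / r ^ 3 + 3 * L ^ 252 / (δ ^ 3 * r ^ 5))
    (hDu0 : 0 ≤ Du) (hDu : Du ≤ L ^ 30 * ε + L ^ 250 / (δ ^ 3 * r ^ 2)) :
    L ^ 114 * floorAgg σ₀ Φ ν Du r * σ₀ ^ 2 ≤ L ^ 20 * ε ^ 2 / r ^ 2 + L ^ 470 / (δ ^ 6 * r ^ 6) := by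
  have hL1 : (1 : ℝ) ≤ L := by linarith
  have hL0 : (0 : ℝ) < L := by linarith
  have hr0 : 0 < r := lt_of_lt_of_le (by positivity) hr
  set R := σ₀ ^ 2 with hR
  have hR0 : 0 ≤ R := by positivity
  have hΦ2 : Φ ^ 2 ≤ (4 * L / (δ ^ 3 * r ^ 4)) ^ 2 := pow_le_pow_left₀ hΦ0 hΦ 2
  have hν2 := sq_le_two_sq_add_two_sq hν0 hν
  have hDu2 := sq_le_two_sq_add_two_sq hDu0 hDu
  -- floorAgg ≤ 2RΦ² + 3R³ν² + Du²/r⁴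
  have hfl : floorAgg σ₀ Φ ν Du r ≤ 2 * R * Φ ^ 2 + 3 * R ^ 3 * ν ^ 2 + Du ^ 2 / r ^ 4 := by
    unfold floorAgg
    rw [show σ₀ ^ 6 = R ^ 3 by rw [hR]; ring]
    have h1 : Φ ^ 2 ≤ R * Φ ^ 2 := le_mul_of_one_le_left (sq_nonneg _) hσ₀
    have hR1 : R ≤ R ^ 3 := by
      calc R = R * 1 * 1 := by ring
        _ ≤ R * R * R := by gcongr
        _ = R ^ 3 := by ring
    have h2 : R * ν ^ 2 ≤ R ^ 3 * ν ^ 2 := mul_le_mul_of_nonneg_right hR1 (sq_nonneg _)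
    have h3 : ν ^ 2 ≤ R ^ 3 * ν ^ 2 := le_mul_of_one_le_left (sq_nonneg _) (hσ₀.trans hR1)
    linarith
  have hstep : L ^ 114 * floorAgg σ₀ Φ ν Du r * σ₀ ^ 2 ≤
      L ^ 114 * (2 * R * Φ ^ 2 + 3 * R ^ 3 * ν ^ 2 + Du ^ 2 / r ^ 4) * R := by
    rw [← hR]; gcongr
  refine hstep.trans ?_
  -- substitute the shapes and R ≤ r/L⁷⁰
  have hb : L ^ 114 * (2 * R * Φ ^ 2 + 3 * R ^ 3 * ν ^ 2 + Du ^ 2 / r ^ 4) * R ≤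
      L ^ 114 * (2 * (r / L ^ 70) * (4 * L / (δ ^ 3 * r ^ 4)) ^ 2 +
        3 * (r / L ^ 70) ^ 3 * (2 * (2 * L ^ 32 * ε / r ^ 3) ^ 2 + 2 * (3 * L ^ 252 / (δ ^ 3 * r ^ 5)) ^ 2) +
        (2 * (L ^ 30 * ε) ^ 2 + 2 * (L ^ 250 / (δ ^ 3 * r ^ 2)) ^ 2) / r ^ 4) * (r / L ^ 70) := by
    gcongr
  refine hb.trans ?_
  have e : L ^ 114 * (2 * (r / L ^ 70) * (4 * L / (δ ^ 3 * r ^ 4)) ^ 2 +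
        3 * (r / L ^ 70) ^ 3 * (2 * (2 * L ^ 32 * ε / r ^ 3) ^ 2 + 2 * (3 * L ^ 252 / (δ ^ 3 * r ^ 5)) ^ 2) +
        (2 * (L ^ 30 * ε) ^ 2 + 2 * (L ^ 250 / (δ ^ 3 * r ^ 2)) ^ 2) / r ^ 4) * (r / L ^ 70) =
      (24 * L ^ 178 / L ^ 280 + (2 * L ^ 174 / L ^ 70) * (1 / r)) * (ε ^ 2 / r ^ 2) +
      (32 * L ^ 116 / L ^ 140 + 54 * L ^ 618 / L ^ 280 + (2 * L ^ 614 / L ^ 70) * (1 / r)) * (1 / (δ ^ 6 * r ^ 6)) := by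
    field_simp; ring
  rw [e]
  have c1 : 24 * L ^ 178 / L ^ 280 ≤ 1 := by
    rw [div_le_one (by positivity)]
    calc 24 * L ^ 178 ≤ L * L ^ 178 := mul_le_mul_of_nonneg_right (by linarith) (by positivity)
      _ = L ^ 179 := by ring
      _ ≤ L ^ 280 := pow_le_pow_right₀ hL1 (by norm_num)
  have c2 : (2 * L ^ 174 / L ^ 70) * (1 / r) ≤ 1 := by
    have h := coef_small (c := (2 : ℝ)) (a := 104) hL1 hr (by linarith) (by norm_num)
    have e2 : 2 * L ^ 174 / L ^ 70 = 2 * L ^ 104 := by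
      rw [div_eq_iff (by positivity)]; ring
    rw [e2]; exact h
  have c3 : 32 * L ^ 116 / L ^ 140 ≤ 1 := by
    rw [div_le_one (by positivity)]
    calc 32 * L ^ 116 ≤ L * L ^ 116 := mul_le_mul_of_nonneg_right (by linarith) (by positivity)
      _ = L ^ 117 := by ring
      _ ≤ L ^ 140 := pow_le_pow_right₀ hL1 (by norm_num)
  have c4 : 54 * L ^ 618 / L ^ 280 ≤ L ^ 339 := by
    rw [div_le_iff₀ (by positivity)]
    calc 54 * L ^ 618 ≤ L * L ^ 618 := mul_le_mul_of_nonneg_right (by linarith) (by positivity)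
      _ = L ^ 339 * L ^ 280 := by ring
  have c5 : (2 * L ^ 614 / L ^ 70) * (1 / r) ≤ L ^ 145 := by
    have h := coef_small (c := (2 : ℝ)) (a := 399) hL1 hr (by linarith) (by norm_num)
    have e2 : 2 * L ^ 614 / L ^ 70 = (2 * L ^ 399) * L ^ 145 := by
      rw [div_eq_iff (by positivity)]; ring
    rw [e2, mul_assoc, mul_comm (L ^ 145), ← mul_assoc]
    calc 2 * L ^ 399 * (1 / r) * L ^ 145 ≤ 1 * L ^ 145 := mul_le_mul_of_nonneg_right h (by positivity)
      _ = L ^ 145 := one_mul _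
  have hA : 24 * L ^ 178 / L ^ 280 + (2 * L ^ 174 / L ^ 70) * (1 / r) ≤ L ^ 20 := by
    have : (2 : ℝ) ≤ L ^ 20 := le_trans (by linarith) (le_self_pow₀ hL1 (by norm_num))
    linarith
  have hB : 32 * L ^ 116 / L ^ 140 + 54 * L ^ 618 / L ^ 280 + (2 * L ^ 614 / L ^ 70) * (1 / r) ≤ L ^ 470 := by
    have h1 : L ^ 339 ≤ L ^ 469 := pow_le_pow_right₀ hL1 (by norm_num)
    have h2 : L ^ 145 ≤ L ^ 469 := pow_le_pow_right₀ hL1 (by norm_num)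
    have h3 : (1 : ℝ) ≤ L ^ 469 := one_le_pow₀ hL1
    have h4 : 3 * L ^ 469 ≤ L ^ 470 := by
      calc 3 * L ^ 469 ≤ L * L ^ 469 := mul_le_mul_of_nonneg_right (by linarith) (by positivity)
        _ = L ^ 470 := by ring
    linarith
  have hx : 0 ≤ ε ^ 2 / r ^ 2 := by positivity
  have hy : 0 ≤ 1 / (δ ^ 6 * r ^ 6) := by positivity
  calc _ ≤ L ^ 20 * (ε ^ 2 / r ^ 2) + L ^ 470 * (1 / (δ ^ 6 * r ^ 6)) :=
        add_le_add (mul_le_mul_of_nonneg_right hA hx) (mul_le_mul_of_nonneg_right hB hy)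
    _ = L ^ 20 * ε ^ 2 / r ^ 2 + L ^ 470 / (δ ^ 6 * r ^ 6) := by ring

/-- Killer with several powers of `1/r`: `c L^a (1/r)^k ≤ 1` for `c ≤ L`, `a + 1 ≤ 400k`, `r ≥ L⁴⁰⁰`. [folklore] -/
theorem killA {L r c : ℝ} {a k : ℕ} (hL : 1 ≤ L) (hr : L ^ 400 ≤ r) (hc : c ≤ L) (hak : a + 1 ≤ 400 * k) :
    c * L ^ a * (1 / r) ^ k ≤ 1 := by
  have hL0 : 0 < L := by linarith
  have hr0 : 0 < r := lt_of_lt_of_le (by positivity) hr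
  have h1 : (1 / r) ^ k ≤ (1 / L ^ 400) ^ k := pow_le_pow_left₀ (by positivity) (one_div_le_one_div_of_le (by positivity) hr) k
  have h2 : c * L ^ a ≤ L ^ (a + 1) := by
    calc c * L ^ a ≤ L * L ^ a := mul_le_mul_of_nonneg_right hc (by positivity)
      _ = L ^ (a + 1) := by ring
  by_cases hc0 : c * L ^ a ≤ 0
  · exact le_trans (mul_nonpos_of_nonpos_of_nonneg hc0 (by positivity)) zero_le_one
  · push Not at hc0
    calc c * L ^ a * (1 / r) ^ k ≤ L ^ (a + 1) * (1 / L ^ 400) ^ k := mul_le_mul h2 h1 (by positivity) (by positivity)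
      _ = L ^ (a + 1) / L ^ (400 * k) := by rw [div_pow, one_pow, ← pow_mul, mul_div_assoc', mul_one]
      _ ≤ 1 := by rw [div_le_one (by positivity)]; exact pow_le_pow_right₀ hL hak

/-- Killer with `δ`: `c L^a / (δ^j r^k) ≤ 1` for `c ≤ L`, `a + 1 ≤ 1000k`, `j ≤ 10k`, `L¹⁰⁰⁰ ≤ δ¹⁰ r`, `δ ≤ 1`.
[folklore] -/
theorem killB {L δ r c : ℝ} {a j k : ℕ} (hL : 1 ≤ L) (hδ : 0 < δ) (hδ1 : δ ≤ 1) (hr : L ^ 1000 ≤ δ ^ 10 * r)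
    (hc : c ≤ L) (hak : a + 1 ≤ 1000 * k) (hjk : j ≤ 10 * k) : c * L ^ a / (δ ^ j * r ^ k) ≤ 1 := by
  have hL0 : 0 < L := by linarith
  have hd : 0 < δ ^ 10 := by positivity
  have h1 : 0 < δ ^ 10 * r := lt_of_lt_of_le (by positivity) hr
  have hr0 : 0 < r := by
    by_contra h
    push Not at h
    have := mul_le_mul_of_nonneg_left h hd.le
    linarith
  have hden : L ^ (1000 * k) ≤ δ ^ j * r ^ k := by
    calc L ^ (1000 * k) = (L ^ 1000) ^ k := by rw [pow_mul]
      _ ≤ (δ ^ 10 * r) ^ k := pow_le_pow_left₀ (by positivity) hr k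
      _ = δ ^ (10 * k) * r ^ k := by rw [mul_pow, ← pow_mul]
      _ ≤ δ ^ j * r ^ k := mul_le_mul_of_nonneg_right (pow_le_pow_of_le_one hδ.le hδ1 hjk) (by positivity)
  have hden0 : 0 < δ ^ j * r ^ k := by positivity
  rw [div_le_one hden0]
  by_cases hc0 : c ≤ 0
  · exact le_trans (mul_nonpos_of_nonpos_of_nonneg hc0 (by positivity)) hden0.le
  · push Not at hc0
    calc c * L ^ a ≤ L * L ^ a := mul_le_mul_of_nonneg_right hc (by positivity)
      _ = L ^ (a + 1) := by ring
      _ ≤ L ^ (1000 * k) := pow_le_pow_right₀ hL hak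
      _ ≤ δ ^ j * r ^ k := hden

/-- Killer with `ε²`: `c L^a ε² ≤ 1` for `c ≤ L`, `a + 1 ≤ 2000`, `L¹⁰⁰⁰ε ≤ δ ≤ 1`. [folklore] -/
theorem killC {L δ ε c : ℝ} {a : ℕ} (hL : 1 ≤ L) (hδ1 : δ ≤ 1) (hε0 : 0 ≤ ε) (hε : L ^ 1000 * ε ≤ δ)
    (hc : c ≤ L) (ha : a + 1 ≤ 2000) : c * L ^ a * ε ^ 2 ≤ 1 := by
  have hL0 : 0 < L := by linarith
  have h1 : L ^ 1000 * ε ≤ 1 := hε.trans hδ1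
  have h2 : (L ^ 1000 * ε) ^ 2 ≤ 1 := pow_le_one₀ (by positivity) h1
  by_cases hc0 : c ≤ 0
  · exact le_trans (mul_nonpos_of_nonpos_of_nonneg (mul_nonpos_of_nonpos_of_nonneg hc0 (by positivity)) (by positivity)) zero_le_one
  · push Not at hc0
    calc c * L ^ a * ε ^ 2 ≤ L * L ^ a * ε ^ 2 := by gcongr
      _ = L ^ (a + 1) * ε ^ 2 := by ring
      _ ≤ L ^ 2000 * ε ^ 2 := mul_le_mul_of_nonneg_right (pow_le_pow_right₀ hL ha) (by positivity)
      _ = (L ^ 1000 * ε) ^ 2 := by ring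
      _ ≤ 1 := h2

end Summit.AtomisticToContinuum.Crystallization.Theorems.ExcessDecayLiouville
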